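import Summits.Ventures.HodgeRepro2.T5SU11RadialGreen

/-!
# The Green's operator of the radial equation on sources that are not compactly supported: the improper
variation-of-parameters formula

Row 451 built the Green's solution `G f = −χ ∫_a^t φ f sinh 2s − φ ∫_t^b χ f sinh 2s` for a source `f` supported in
`[a, b] ⊂ (0, ∞)`. For a continuous source `g` on `(0, ∞)` that is merely INTEGRABLE against the basis — `φ g sinh 2s`
integrable on every `(0, T]` and `χ g sinh 2s` integrable on `(0, ∞)` — the same formula with improper limits,

  **`(G^I g)(t) := −χ(t) ∫_{(0, t]} φ g sinh 2s − φ(t) ∫_{(t, ∞)} χ g sinh 2s`** (`greenSolI`),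

is again a solution of the inhomogeneous equation `sinh 2t · u″ + 2 cosh 2t · u′ = μ sinh 2t · u + sinh 2t · g` on
`(0, ∞)` (`greenSolI_ode`): `B^I(t) = ∫_{(0,t]} φ g sinh` has derivative `φ g sinh 2t` (`hasDerivAt_greenBI`: the
fundamental theorem of calculus after `∫_{(0,t]} = ∫_0^t`), `A^I(t) = ∫_{(t,∞)} χ g sinh = ∫_{(0,∞)} − ∫_{(0,t]}` has
derivative `−χ g sinh 2t` (`greenAI_eq`, `hasDerivAt_greenAI`), the cross terms cancel (`hasDerivAt_greenSolI`,
`hasDerivAt_greenSolI'`), and the Wronskian `sinh 2t (φ χ′ − φ′ χ) = −1` produces the source. For a source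
supported in `[a, b]` the improper formula IS row 451's (`greenSolI_eq_greenSol`). Nothing is claimed about (N).

Blind lane: Mathlib + the HodgeRepro2 prefix only; no sorry; axioms ⊆ {propext, Classical.choice,
Quot.sound}.
-/

namespace Summit.Ventures.HodgeRepro2.T5SU11RadialGreenImproper

open Filter Topology MeasureTheory intervalIntegral
open Set (Ioi Ioc Icc uIcc)
open T5SU11ReductionOfOrder T5SU11RadialGreen

/-- `B^I(t) = ∫_{(0, t]} φ(s) g(s) sinh 2s ds`. -/
noncomputable def greenBI (φ g : ℝ → ℝ) (t : ℝ) : ℝ := ∫ s in Ioc 0 t, φ s * g s * Real.sinh (2 * s)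

/-- `A^I(t) = ∫_{(t, ∞)} χ(s) g(s) sinh 2s ds`. -/
noncomputable def greenAI (χ g : ℝ → ℝ) (t : ℝ) : ℝ := ∫ s in Ioi t, χ s * g s * Real.sinh (2 * s)

/-- **The improper Green's solution** `(G^I g)(t) = −χ(t) B^I(t) − φ(t) A^I(t)`. -/
noncomputable def greenSolI (φ χ g : ℝ → ℝ) (t : ℝ) : ℝ := -(χ t * greenBI φ g t) - φ t * greenAI χ g t

/-- `(G^I g)′ = −χ′ B^I − φ′ A^I`. -/
noncomputable def greenSolI' (φ' χ' φ χ g : ℝ → ℝ) (t : ℝ) : ℝ :=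
  -(χ' t * greenBI φ g t) - φ' t * greenAI χ g t

/-- `(G^I g)″ = −χ″ B^I − φ″ A^I − (χ′ φ − φ′ χ) g sinh 2t`. -/
noncomputable def greenSolI'' (φ'' χ'' φ' χ' φ χ g : ℝ → ℝ) (t : ℝ) : ℝ :=
  -(χ'' t * greenBI φ g t) - φ'' t * greenAI χ g t - (χ' t * φ t - φ' t * χ t) * g t * Real.sinh (2 * t)

section

variable {μ : ℝ} {φ φ' φ'' χ χ' χ'' g : ℝ → ℝ}
  (hφ : ∀ t, 0 < t → HasDerivAt φ (φ' t) t) (hφ' : ∀ t, 0 < t → HasDerivAt φ' (φ'' t) t)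
  (hφode : ∀ t, 0 < t → Real.sinh (2 * t) * φ'' t + 2 * Real.cosh (2 * t) * φ' t = μ * Real.sinh (2 * t) * φ t)
  (hχ : ∀ t, 0 < t → HasDerivAt χ (χ' t) t) (hχ' : ∀ t, 0 < t → HasDerivAt χ' (χ'' t) t)
  (hχode : ∀ t, 0 < t → Real.sinh (2 * t) * χ'' t + 2 * Real.cosh (2 * t) * χ' t = μ * Real.sinh (2 * t) * χ t)
  (hW : ∀ t, 0 < t → Real.sinh (2 * t) * (φ t * χ' t - φ' t * χ t) = -1)
  (hg : ContinuousOn g (Ioi 0))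
  (hB : ∀ T, IntegrableOn (fun s => φ s * g s * Real.sinh (2 * s)) (Ioc 0 T))
  (hA : IntegrableOn (fun s => χ s * g s * Real.sinh (2 * s)) (Ioi 0))

/-! ### The fundamental theorem of calculus for the two improper integrals -/

include hφ hg hB in
/-- **`(B^I)′(t) = φ(t) g(t) sinh 2t`** on `(0, ∞)`. -/
theorem hasDerivAt_greenBI {t : ℝ} (ht : 0 < t) :
    HasDerivAt (greenBI φ g) (φ t * g t * Real.sinh (2 * t)) t := by
  have hc := continuousOn_greenB_integrand hφ hg
  have h : HasDerivAt (fun u => ∫ s in (0 : ℝ)..u, φ s * g s * Real.sinh (2 * s))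
      (φ t * g t * Real.sinh (2 * t)) t :=
    integral_hasDerivAt_right ((intervalIntegrable_iff_integrableOn_Ioc_of_le ht.le).mpr (hB t))
      (hc.stronglyMeasurableAtFilter isOpen_Ioi t ht) (hc.continuousAt (isOpen_Ioi.mem_nhds ht))
  refine h.congr_of_eventuallyEq ?_
  filter_upwards [Ioi_mem_nhds ht] with u hu
  unfold greenBI
  rw [integral_of_le (le_of_lt hu)]

include hA in
/-- **`A^I(t) = ∫_{(0,∞)} χ g sinh − ∫_{(0,t]} χ g sinh`** for `t > 0`. -/
theorem greenAI_eq {t : ℝ} (ht : 0 < t) :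
    greenAI χ g t = (∫ s in Ioi 0, χ s * g s * Real.sinh (2 * s)) - ∫ s in Ioc 0 t, χ s * g s * Real.sinh (2 * s) := by
  have hsplit : Ioc 0 t ∪ Ioi t = Ioi 0 := Set.Ioc_union_Ioi_eq_Ioi ht.le
  have hdisj : Disjoint (Ioc 0 t) (Ioi t) := Set.Ioc_disjoint_Ioi le_rfl
  have h := setIntegral_union hdisj measurableSet_Ioi (hA.mono_set (by rw [← hsplit]; exact Set.subset_union_left))
    (hA.mono_set (by rw [← hsplit]; exact Set.subset_union_right))
  rw [hsplit] at h
  unfold greenAI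
  rw [h]
  ring

include hχ hg hA in
/-- **`(A^I)′(t) = −χ(t) g(t) sinh 2t`** on `(0, ∞)`. -/
theorem hasDerivAt_greenAI {t : ℝ} (ht : 0 < t) :
    HasDerivAt (greenAI χ g) (-(χ t * g t * Real.sinh (2 * t))) t := by
  have hc := continuousOn_greenB_integrand hχ hg
  have hBχ : ∀ T, IntegrableOn (fun s => χ s * g s * Real.sinh (2 * s)) (Ioc 0 T) := fun T =>
    hA.mono_set (fun s hs => hs.1)
  have h : HasDerivAt (fun u => (∫ s in Ioi 0, χ s * g s * Real.sinh (2 * s))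
      - ∫ s in (0 : ℝ)..u, χ s * g s * Real.sinh (2 * s)) (-(χ t * g t * Real.sinh (2 * t))) t := by
    have := (integral_hasDerivAt_right ((intervalIntegrable_iff_integrableOn_Ioc_of_le ht.le).mpr (hBχ t))
      (hc.stronglyMeasurableAtFilter isOpen_Ioi t ht) (hc.continuousAt (isOpen_Ioi.mem_nhds ht))).const_sub
      (∫ s in Ioi 0, χ s * g s * Real.sinh (2 * s))
    exact this
  refine h.congr_of_eventuallyEq ?_
  filter_upwards [Ioi_mem_nhds ht] with u hu
  rw [greenAI_eq hA hu, integral_of_le (le_of_lt hu)]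

/-! ### The derivatives of the improper Green's solution -/

include hφ hχ hg hB hA in
/-- **`(G^I g)′ = −χ′ B^I − φ′ A^I`**: the cross terms cancel. -/
theorem hasDerivAt_greenSolI {t : ℝ} (ht : 0 < t) :
    HasDerivAt (greenSolI φ χ g) (greenSolI' φ' χ' φ χ g t) t := by
  have h1 := ((hχ t ht).mul (hasDerivAt_greenBI hφ hg hB ht)).neg
  have h2 := (hφ t ht).mul (hasDerivAt_greenAI hχ hg hA ht)
  have h := h1.sub h2
  show HasDerivAt (fun t => -(χ t * greenBI φ g t) - φ t * greenAI χ g t) _ t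
  refine h.congr_deriv ?_
  unfold greenSolI'
  ring

include hφ hφ' hχ hχ' hg hB hA in
/-- **`(G^I g)″ = −χ″ B^I − φ″ A^I − (χ′ φ − φ′ χ) g sinh 2t`.** -/
theorem hasDerivAt_greenSolI' {t : ℝ} (ht : 0 < t) :
    HasDerivAt (greenSolI' φ' χ' φ χ g) (greenSolI'' φ'' χ'' φ' χ' φ χ g t) t := by
  have h1 := ((hχ' t ht).mul (hasDerivAt_greenBI hφ hg hB ht)).neg
  have h2 := (hφ' t ht).mul (hasDerivAt_greenAI hχ hg hA ht)
  have h := h1.sub h2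
  show HasDerivAt (fun t => -(χ' t * greenBI φ g t) - φ' t * greenAI χ g t) _ t
  refine h.congr_deriv ?_
  unfold greenSolI''
  ring

/-! ### The inhomogeneous equation -/

include hφode hχode hW in
/-- **THE IMPROPER GREEN'S SOLUTION SOLVES THE INHOMOGENEOUS EQUATION**:
`sinh 2t · (G^I g)″ + 2 cosh 2t · (G^I g)′ = μ sinh 2t · (G^I g) + sinh 2t · g` on `(0, ∞)`. -/
theorem greenSolI_ode {t : ℝ} (ht : 0 < t) :
    Real.sinh (2 * t) * greenSolI'' φ'' χ'' φ' χ' φ χ g t + 2 * Real.cosh (2 * t) * greenSolI' φ' χ' φ χ g t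
      = μ * Real.sinh (2 * t) * greenSolI φ χ g t + Real.sinh (2 * t) * g t := by
  unfold greenSolI'' greenSolI' greenSolI
  have e1 := hφode t ht
  have e2 := hχode t ht
  have e3 := hW t ht
  linear_combination -(greenAI χ g t) * e1 - (greenBI φ g t) * e2 - (Real.sinh (2 * t) * g t) * e3

/-! ### Consistency with the compactly supported case -/

include hφ hχ hg in
/-- **For a source supported in `[a, b]` the improper formula is row 451's `G g`.** -/
theorem greenSolI_eq_greenSol {a b : ℝ} (ha : 0 < a) (hab : a ≤ b) (hga : ∀ s, s ≤ a → g s = 0)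
    (hgb : ∀ s, b ≤ s → g s = 0) {t : ℝ} (ht : 0 < t) : greenSolI φ χ g t = greenSol φ χ g a b t := by
  have hb : 0 < b := lt_of_lt_of_le ha hab
  have hcφ := continuousOn_greenB_integrand hφ hg
  have hcχ := continuousOn_greenB_integrand hχ hg
  -- `B^I(t) = ∫_a^t φ g sinh`: the integrand vanishes on `(0, a]`
  have hBeq : greenBI φ g t = greenB φ g a t := by
    unfold greenBI greenB
    rw [← integral_of_le ht.le]
    have hzero : ∀ s, s ≤ a → φ s * g s * Real.sinh (2 * s) = 0 := fun s hs => by rw [hga s hs]; ring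
    have hz0a : ∫ s in (0 : ℝ)..a, φ s * g s * Real.sinh (2 * s) = 0 := by
      rw [integral_congr (g := fun _ => (0 : ℝ)) (fun s hs => hzero s ?_), intervalIntegral.integral_zero]
      rw [Set.uIcc_of_le ha.le] at hs
      exact hs.2
    rcases le_or_gt t a with hta | hta
    · have hz0t : ∫ s in (0 : ℝ)..t, φ s * g s * Real.sinh (2 * s) = 0 := by
        rw [integral_congr (g := fun _ => (0 : ℝ)) (fun s hs => hzero s ?_), intervalIntegral.integral_zero]
        rw [Set.uIcc_of_le ht.le] at hs
        exact le_trans hs.2 hta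
      have hzat : ∫ s in a..t, φ s * g s * Real.sinh (2 * s) = 0 := by
        rw [integral_congr (g := fun _ => (0 : ℝ)) (fun s hs => hzero s ?_), intervalIntegral.integral_zero]
        rw [Set.uIcc_of_ge hta] at hs
        exact hs.2
      rw [hz0t, hzat]
    · have hint : IntervalIntegrable (fun s => φ s * g s * Real.sinh (2 * s)) volume 0 a := by
        refine (intervalIntegrable_iff_integrableOn_Ioc_of_le ha.le).mpr ?_
        exact integrableOn_zero.congr_fun (fun s hs => (hzero s hs.2).symm) measurableSet_Ioc
      have hint2 : IntervalIntegrable (fun s => φ s * g s * Real.sinh (2 * s)) volume a t :=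
        ((hcφ.mono (uIcc_subset_Ioi ha ht)).intervalIntegrable)
      rw [← integral_add_adjacent_intervals hint hint2, hz0a, zero_add]
  -- `A^I(t) = ∫_t^b χ g sinh`: the integrand vanishes on `[b, ∞)`
  have hAeq : greenAI χ g t = greenA χ g b t := by
    unfold greenAI greenA
    have hzero : ∀ s, b ≤ s → χ s * g s * Real.sinh (2 * s) = 0 := fun s hs => by rw [hgb s hs]; ring
    have hzb : ∫ s in Ioi b, χ s * g s * Real.sinh (2 * s) = 0 := by
      rw [setIntegral_congr_fun measurableSet_Ioi (g := fun _ => (0 : ℝ)) (fun s hs => hzero s (le_of_lt hs)),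
        setIntegral_const, smul_zero]
    rcases le_or_gt b t with hbt | hbt
    · have hzt : ∫ s in Ioi t, χ s * g s * Real.sinh (2 * s) = 0 := by
        rw [setIntegral_congr_fun measurableSet_Ioi (g := fun _ => (0 : ℝ))
          (fun s hs => hzero s (le_trans hbt (le_of_lt hs))), setIntegral_const, smul_zero]
      have hztb : ∫ s in t..b, χ s * g s * Real.sinh (2 * s) = 0 := by
        rw [integral_congr (g := fun _ => (0 : ℝ)) (fun s hs => hzero s ?_), intervalIntegral.integral_zero]
        rw [Set.uIcc_of_ge hbt] at hs
        exact hs.1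
      rw [hzt, hztb]
    · have hsplit : Ioc t b ∪ Ioi b = Ioi t := Set.Ioc_union_Ioi_eq_Ioi hbt.le
      have hdisj : Disjoint (Ioc t b) (Ioi b) := Set.Ioc_disjoint_Ioi le_rfl
      have hI1 : IntegrableOn (fun s => χ s * g s * Real.sinh (2 * s)) (Ioc t b) :=
        ((hcχ.mono (fun s hs => lt_of_lt_of_le ht hs.1)).integrableOn_Icc).mono_set Set.Ioc_subset_Icc_self
      have hI2 : IntegrableOn (fun s => χ s * g s * Real.sinh (2 * s)) (Ioi b) :=
        integrableOn_zero.congr_fun (fun s hs => (hzero s (le_of_lt hs)).symm) measurableSet_Ioi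
      rw [← hsplit, setIntegral_union hdisj measurableSet_Ioi hI1 hI2, hzb, add_zero, ← integral_of_le hbt.le]
  unfold greenSolI greenSol
  rw [hBeq, hAeq]

end

end Summit.Ventures.HodgeRepro2.T5SU11RadialGreenImproper
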